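import Literature.AlgebraicGeometry.Resolution.QuadraticTransformsStructure
import Literature.AlgebraicGeometry.Resolution.QuadraticTransformWeakTransform

/-!
# The strict transform of a plane curve germ along a quadratic transform

Helper file for the stub `exists_strictTransform_of_isQuadraticTransformAlong` (T4, the first
lemma of embedded resolution of plane curve germs along a valuation: the multiplicity of the
strict transform does not increase) of the line `pfaff-line-log-final-forms` (crux
`Valuative.LuAlphaPTorsor`, item `stmt-ResolutionOfSingularities-0641`).

Setting: `R ⊆ K` a two-dimensional regular local ring dominated by the valuation ring `O`, and
`R₁` the quadratic transform of `R` along `O` (`IsQuadraticTransformAlong O R R₁`): by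
`IsQuadraticTransformAlong.exists_eq_locAtCentre`, `R₁ = (R[𝔪/x])_{𝔪_O ∩ R[𝔪/x]}` for a
generator `x` of `𝔪 = 𝔪_R` of minimal value; `x ∉ 𝔪²`, so `𝔪 = (x, y)` and the chart is
`A = R[y/x] ≅ R[X]/(xX - y)` with exceptional prime `xA = 𝔪A` and `A/xA ≅ κ[X]`
(`QuadraticTransformsChart.lean`).

* `exists_strictTransform_of_isQuadraticTransformAlong` — for `g ∈ 𝔪ᵉ ∖ 𝔪ᵉ⁺¹`:
  `g = xᵉ g₁` with `g₁ = F(y/x) ∈ A ⊆ R₁`, `F ∈ R[X]` of degree `≤ e` with non-zero reduction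
  `F̄ ∈ κ[X]`; `x ∤ g₁` in `R₁` (else `g ∈ xᵉ⁺¹A ∩ R = 𝔪ᵉ⁺¹`, the powers of `𝔪` being
  contracted from the chart, `comap_map_pow_maximalIdeal`); and `g₁ ∉ 𝔪₁ᵉ⁺¹`: reducing modulo
  `xA` through `A → κ[X]`, `g₁ ∈ 𝔪₁ᵉ⁺¹ = Qᵉ⁺¹R₁` (`Q = 𝔪_O ∩ A`) would give `t F̄ ∈ Q̄ᵉ⁺¹`
  with `t ∉ Q̄` for the prime `Q̄ = (P)` of the principal ideal domain `κ[X]`, forcing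
  `Pᵉ⁺¹ ∣ F̄`, impossible for `deg F̄ ≤ e` (and for `Q̄ = 0`, `F̄ = 0`).

References: O. Zariski, P. Samuel, *Commutative Algebra* II (1960), Appendix 5;
C. Huneke, I. Swanson, *Integral Closure of Ideals, Rings, and Modules* (2006), §14.2–14.3.
-/

set_option linter.dupNamespace false

noncomputable section

open IsLocalRing Polynomial Literature.AlgebraicGeometry.Resolution

namespace Summit.ResolutionOfSingularities.ResolutionOfSingularities.Theorems.PfaffLine

section StrictTransform

variable {K : Type*} [Field K]

/-- For `𝔪 = (x, y)` in a local subring `R ⊆ K`: every `g ∈ 𝔪ᵉ` is `xᵉ · F(y/x)` for a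
polynomial `F ∈ R[X]` of degree `≤ e`. [folklore] -/
private theorem exists_eq_pow_mul_aeval_strictTransform {R : Subring K} [IsLocalRing R] {x y : R}
    (hm : maximalIdeal R = Ideal.span {x, y}) (hx0 : ((x : R) : K) ≠ 0) :
    ∀ (e : ℕ) (g : R), g ∈ maximalIdeal R ^ e →
      ∃ F : R[X], F.natDegree ≤ e ∧
        (g : K) = ((x : R) : K) ^ e * aeval (((y : R) : K) / ((x : R) : K)) F := by
  intro e
  induction e with
  | zero =>
    intro g _
    refine ⟨C g, by simp, ?_⟩
    rw [aeval_C, pow_zero, one_mul]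
    rfl
  | succ e ih =>
    intro g hg
    rw [pow_succ] at hg
    refine Submodule.smul_induction_on (p := fun r : R => ∃ F : R[X], F.natDegree ≤ e + 1 ∧
      (r : K) = ((x : R) : K) ^ (e + 1) * aeval (((y : R) : K) / ((x : R) : K)) F) hg ?_ ?_
    · intro m hm' n hn
      obtain ⟨F, hF, hmF⟩ := ih m hm'
      rw [hm, Ideal.mem_span_pair] at hn
      obtain ⟨a, b, rfl⟩ := hn
      refine ⟨C a * F + C b * F * X, ?_, ?_⟩
      · refine natDegree_add_le_of_degree_le ((natDegree_C_mul_le a F).trans (by omega)) ?_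
        exact natDegree_mul_le.trans
          (add_le_add ((natDegree_C_mul_le b F).trans hF) natDegree_X_le)
      · rw [smul_eq_mul, Subring.coe_mul, hmF, Subring.coe_add, Subring.coe_mul,
          Subring.coe_mul]
        simp only [map_add, map_mul, aeval_C, aeval_X]
        rw [show (algebraMap R K a : K) = a from rfl, show (algebraMap R K b : K) = b from rfl]
        field_simp
        ring
    · rintro r s ⟨F, hF, hrF⟩ ⟨G, hG, hsG⟩
      refine ⟨F + G, natDegree_add_le_of_degree_le hF hG, ?_⟩
      rw [Subring.coe_add, hrF, hsG, map_add, mul_add]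

/-- For `𝔪 = (x, y)`: if `g = xᵉ F(y/x)` with `deg F ≤ e` and all coefficients of `F` in `𝔪`,
then `g ∈ 𝔪ᵉ⁺¹` (`g = Σ Fᵢ yⁱ xᵉ⁻ⁱ`). [folklore] -/
private theorem mem_pow_succ_of_coeff_mem_strictTransform {R : Subring K} [IsLocalRing R]
    {x y : R} (hm : maximalIdeal R = Ideal.span {x, y}) (hx0 : ((x : R) : K) ≠ 0) {e : ℕ}
    {g : R} {F : R[X]} (hF : F.natDegree ≤ e) (hc : ∀ i, F.coeff i ∈ maximalIdeal R)
    (hg : (g : K) = ((x : R) : K) ^ e * aeval (((y : R) : K) / ((x : R) : K)) F) :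
    g ∈ maximalIdeal R ^ (e + 1) := by
  have hxm : x ∈ maximalIdeal R := hm ▸ Ideal.subset_span (by simp)
  have hym : y ∈ maximalIdeal R := hm ▸ Ideal.subset_span (by simp)
  have hsum : g = ∑ i ∈ Finset.range (e + 1), F.coeff i * y ^ i * x ^ (e - i) := by
    apply Subtype.ext
    rw [hg, aeval_eq_sum_range' (Nat.lt_succ_of_le hF), Finset.mul_sum]
    push_cast
    refine Finset.sum_congr rfl fun i hi => ?_
    have hi' : i ≤ e := Nat.lt_succ_iff.mp (Finset.mem_range.mp hi)
    rw [Algebra.smul_def, div_pow, show (algebraMap R K (F.coeff i) : K) = F.coeff i from rfl]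
    have hsplit : ((x : R) : K) ^ e = ((x : R) : K) ^ i * ((x : R) : K) ^ (e - i) := by
      rw [← pow_add, Nat.add_sub_cancel' hi']
    rw [hsplit]
    field_simp
  rw [hsum]
  refine Ideal.sum_mem _ fun i hi => ?_
  have hi' : i ≤ e := Nat.lt_succ_iff.mp (Finset.mem_range.mp hi)
  rw [pow_succ', mul_assoc]
  refine Ideal.mul_mem_mul (hc i) ?_
  have := Ideal.mul_mem_mul (Ideal.pow_mem_pow hym i) (Ideal.pow_mem_pow hxm (e - i))
  rwa [← pow_add, Nat.add_sub_cancel' hi'] at this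

/-- In `k[X]` (a principal ideal domain): if `a ∉ P` for a prime `P`, `a b ∈ Pᵉ⁺¹` and `b ≠ 0`,
then `deg b > e` (`P = (p)`: for `p = 0`, `b = 0`; else `pᵉ⁺¹ ∣ b`). [folklore] -/
private theorem lt_natDegree_of_mul_mem_pow_strictTransform {k : Type*} [Field k]
    {P : Ideal k[X]} [hP : P.IsPrime] {a b : k[X]} {e : ℕ} (ha : a ∉ P)
    (hab : a * b ∈ P ^ (e + 1)) (hb : b ≠ 0) : e < b.natDegree := by
  have hPgen : P = Ideal.span {Submodule.IsPrincipal.generator P} :=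
    (Ideal.span_singleton_generator P).symm
  set p := Submodule.IsPrincipal.generator P with hp
  by_cases hp0 : p = 0
  · rw [hPgen, hp0] at ha hab
    simp only [Ideal.span_singleton_zero] at ha hab
    rw [pow_succ, Ideal.mul_bot, Ideal.mem_bot, mul_eq_zero] at hab
    rcases hab with h | h
    · exact absurd (h ▸ (Submodule.zero_mem ⊥ : (0 : k[X]) ∈ (⊥ : Ideal k[X]))) ha
    · exact absurd h hb
  · have hprime : Prime p := (Ideal.span_singleton_prime hp0).mp (hPgen ▸ hP)
    rw [hPgen, Ideal.mem_span_singleton] at ha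
    rw [hPgen, Ideal.span_singleton_pow, Ideal.mem_span_singleton] at hab
    have hdvd : p ^ (e + 1) ∣ b := hprime.pow_dvd_of_dvd_mul_left (e + 1) ha hab
    have h1 := natDegree_le_of_dvd hdvd hb
    rw [natDegree_pow] at h1
    have h2 : 0 < p.natDegree :=
      natDegree_pos_iff_degree_pos.mpr (degree_pos_of_ne_zero_of_nonunit hp0 hprime.not_unit)
    have h3 : e + 1 ≤ (e + 1) * p.natDegree := Nat.le_mul_of_pos_right _ h2
    omega

end StrictTransform

/-- **Strict transform of a plane curve germ at a quadratic transform along a valuation**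
(Zariski–Samuel II, App. 5; Huneke–Swanson §14.2: the multiplicity of the strict transform does
not exceed that of the germ). Let `R ⊆ K` be a two-dimensional regular local ring dominated by
the valuation ring `O`, `R₁` the quadratic transform of `R` along `O`, and `g ∈ 𝔪ᵉ ∖ 𝔪ᵉ⁺¹`.
Then for the generator `x` of `𝔪` of minimal value (`R₁ = (R[𝔪/x])_{𝔪_O ∩ R[𝔪/x]}`):
`g = xᵉ g₁` with `g₁ ∈ R₁`, `g₁/x ∉ R₁`, and `g₁ ∉ 𝔪_{R₁}ᵉ⁺¹`. Proof: with `𝔪 = (x, y)` and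
the chart `A = R[y/x]`, `g₁ = F(y/x)` for `F ∈ R[X]` of degree `≤ e` with `F̄ ≠ 0` in `κ[X]`;
`x ∤ g₁` as `xᵉ⁺¹A ∩ R = 𝔪ᵉ⁺¹` (and `xA` is prime, denominators of `R₁` have value `0`);
`g₁ ∉ 𝔪₁ᵉ⁺¹` by reduction `A → A/xA ≅ κ[X]`, where a non-zero polynomial of degree `≤ e` is
not in the `(e+1)`st power of a prime localised. [folklore] -/
theorem exists_strictTransform_of_isQuadraticTransformAlong : ∀ {K : Type} [Field K] (O : ValuationSubring K) (R R₁ : Subring K) [IsRegularLocalRing R] [IsLocalRing R₁] (h : Literature.AlgebraicGeometry.Resolution.IsQuadraticTransformAlong O R R₁), ringKrullDim R = 2 → Literature.AlgebraicGeometry.Resolution.SubringDominates R O.toSubring → ∀ (g : R) (e : ℕ), g ∈ maximalIdeal R ^ e → g ∉ maximalIdeal R ^ (e + 1) → ∃ (x : R) (g₁ : R₁), x ∈ maximalIdeal R ∧ (x : K) ≠ 0 ∧ (∀ y ∈ maximalIdeal R, O.valuation (y : K) ≤ O.valuation (x : K)) ∧ (g : K) = (x : K) ^ e * (g₁ : K)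 ∧ (g₁ : K) / (x : K) ∉ R₁ ∧ g₁ ∉ maximalIdeal R₁ ^ (e + 1) := by
  intro K _ O R R₁ _ _ h hdim hdom g e hge hge1
  classical
  -- the exceptional parameter `x` and `R₁ = (R[𝔪/x])_{𝔪_O ∩ R[𝔪/x]}`
  obtain ⟨_, x, hxm, hx0, hmin, hR₁⟩ := h.exists_eq_locAtCentre
  have hx0K : ((x : R) : K) ≠ 0 := fun e => hx0 (Subtype.ext e)
  have hRO : R ≤ O.toSubring := h.source_le
  have hνx : O.valuation ((x : R) : K) < 1 :=
    ((subringDominates_valuationSubring_iff hRO).mp hdom x).mp hxm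
  have hq : IsQuadraticTransform R R₁ := h.isQuadraticTransform hdom
  have hT : blowupRing R ((x : R) : K) ≤ R₁ := hR₁ ▸ le_locAtCentre _ O
  have hx2 : x ∉ maximalIdeal R ^ 2 := IsQuadraticTransform.chart_not_mem_sq hT hq.dominates hx0
  obtain ⟨y, hm, hxp, hxy⟩ := exists_maximalIdeal_eq_span_pair_of_not_mem_sq hdim hxm hx2
  have hpq : ∀ t, x ∣ y * t → x ∣ t := fun t ht => (hxp.dvd_or_dvd ht).resolve_left hxy
  have hym : y ∈ maximalIdeal R := hm ▸ Ideal.subset_span (by simp)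
  -- the chart `A = R[y/x] = R[𝔪/x]` and `R₁ = A_{𝔪_O ∩ A}`
  have hA : blowupRing R ((x : R) : K) = chartAdjoin (K := K) x y := blowupRing_eq_adjoin hm
  have hR₁A : R₁ = locAtCentre (chartAdjoin (K := K) x y) O := by rw [hR₁, hA]
  subst hR₁A
  set u : K := ((y : R) : K) / ((x : R) : K) with hu
  set A : Subring K := chartAdjoin (K := K) x y with hAdef
  have hAle : A ≤ locAtCentre A O := le_locAtCentre A O
  have hAO : A ≤ O.toSubring := hAle.trans h.target_le
  letI : Algebra R A := (chartIncl x y).toAlgebra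
  have halg : algebraMap R A = chartIncl x y := rfl
  have hinj : Function.Injective (algebraMap R A) := chartIncl_injective x y
  have hmS : (maximalIdeal R).map (algebraMap R A) = Ideal.span {algebraMap R A x} :=
    map_maximalIdeal_chartIncl hm hx0
  have hS2 := exists_pow_mul_eq_chartIncl (K := K) hm hx0
  haveI h𝔭 : (Ideal.span {algebraMap R A x}).IsPrime := by
    rw [← hmS, halg]
    exact isPrime_map_incl (K := K) hx0 hpq hxm hym
  -- `g = xᵉ F(u)` with `deg F ≤ e`
  obtain ⟨F, hFdeg, hgF⟩ := exists_eq_pow_mul_aeval_strictTransform hm hx0K e g hge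
  have hFA : aeval u F ∈ A := Polynomial.aeval_mem_adjoin_singleton R u
  set s : A := ⟨aeval u F, hFA⟩ with hs
  refine ⟨x, ⟨aeval u F, hAle hFA⟩, hxm, hx0K, hmin, hgF, ?_, ?_⟩
  · -- `x ∤ g₁` in `R₁`
    intro hmem
    obtain ⟨a, ha, b, hb, hvb, hab⟩ := mem_locAtCentre_iff.mp hmem
    have hb0 : b ≠ 0 := ne_zero_of_valuation_eq_one hvb
    change aeval u F / ((x : R) : K) = a / b at hab
    rw [div_eq_div_iff hx0K hb0] at hab
    -- `s b = a x` lies in the prime `xA`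
    have hsb : s * ⟨b, hb⟩ ∈ Ideal.span {algebraMap R A x} := by
      refine Ideal.mem_span_singleton'.mpr ⟨⟨a, ha⟩, Subtype.ext ?_⟩
      change a * ((x : R) : K) = aeval u F * b
      rw [hab]
    rcases h𝔭.mem_or_mem hsb with hsx | hbx
    · -- `s = c x`, so `g = xᵉ⁺¹ c ∈ xᵉ⁺¹ A ∩ R = 𝔪ᵉ⁺¹`
      obtain ⟨c, hc⟩ := Ideal.mem_span_singleton'.mp hsx
      have hc' : (c : K) * ((x : R) : K) = aeval u F := congrArg (fun z : A => (z : K)) hc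
      apply hge1
      rw [← comap_map_pow_maximalIdeal hxm hx2 hinj hmS hS2 (e + 1), Ideal.mem_comap,
        map_pow_maximalIdeal_eq_span hmS, Ideal.mem_span_singleton']
      refine ⟨c, Subtype.ext ?_⟩
      calc ((c * algebraMap R A x ^ (e + 1) : A) : K) = (c : K) * ((x : R) : K) ^ (e + 1) := by
            rw [Subring.coe_mul, Subring.coe_pow]; rfl
        _ = ((x : R) : K) ^ e * ((c : K) * ((x : R) : K)) := by ring
        _ = (g : K) := by rw [hc', hgF]
    · -- `b = c x` would have value `< 1`
      obtain ⟨c, hc⟩ := Ideal.mem_span_singleton'.mp hbx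
      have hc' : (c : K) * ((x : R) : K) = b := congrArg (fun z : A => (z : K)) hc
      have hνc : O.valuation (c : K) ≤ 1 := (O.valuation_le_one_iff _).mpr (hAO c.2)
      have hlt : O.valuation b < 1 := by
        rw [← hc', map_mul]
        calc O.valuation (c : K) * O.valuation ((x : R) : K)
            ≤ 1 * O.valuation ((x : R) : K) := mul_le_mul_left hνc _
          _ < 1 := by rw [one_mul]; exact hνx
      exact hlt.ne hvb
  · -- `g₁ ∉ 𝔪₁ᵉ⁺¹`
    intro hg₁
    haveI := isLocalization_locAtCentre hAO
    set Q := subringCentre A O hAO with hQdef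
    have hxQ : algebraMap R A x ∈ Q := (mem_subringCentre_iff hAO _).mpr hνx
    have hmax : maximalIdeal (locAtCentre A O) = Q.map (algebraMap A (locAtCentre A O)) :=
      (IsLocalization.AtPrime.map_eq_maximalIdeal Q (locAtCentre A O)).symm
    rw [hmax, ← Ideal.map_pow,
      IsLocalization.mem_map_algebraMap_iff Q.primeCompl (locAtCentre A O)] at hg₁
    obtain ⟨⟨⟨a, ha⟩, ⟨t, ht⟩⟩, hat⟩ := hg₁
    have hts : t * s ∈ Q ^ (e + 1) := by
      have e1 := congrArg (fun z : locAtCentre A O => (z : K)) hat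
      have : t * s = a := Subtype.ext (by
        change (t : K) * aeval u F = a
        rw [mul_comm]
        exact e1)
      rw [this]
      exact ha
    have htQ : t ∉ Q := ht
    -- the reduction map `φ : A → κ[X]` (`A ≅ R[X]/(xX - y)`, `A/xA ≅ κ[X]`)
    set ψ : R[X] →+* A := (aeval u).toRingHom.codRestrict (Algebra.adjoin R {u}).toSubring
      (fun _ => Polynomial.aeval_mem_adjoin_singleton R u) with hψdef
    have hψ : Function.Surjective ψ := aevalCod_surjective R u _
    have hψF : ψ F = s := rfl
    set ρ : R[X] →+* (ResidueField R)[X] := mapRingHom (residue R) with hρ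
    have hρker : ∀ p : R[X], ρ p = 0 ↔ ∀ i, p.coeff i ∈ maximalIdeal R := fun p => by
      rw [Polynomial.ext_iff]
      refine forall_congr' fun i => ?_
      rw [hρ, coe_mapRingHom, coeff_map, coeff_zero, residue_eq_zero_iff]
    have hker : RingHom.ker ψ ≤ RingHom.ker ρ := by
      intro p hp
      have hp' := ker_aevalCod_le hx0 hpq _ hp
      rw [RingHom.mem_ker, hρker]
      intro i
      rw [hm]
      exact Ideal.mem_map_C_iff.mp hp' i
    set φ : A →+* (ResidueField R)[X] := ψ.liftOfSurjective hψ ⟨ρ, hker⟩ with hφdef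
    have hφψ : ∀ p, φ (ψ p) = ρ p := fun p => ψ.liftOfSurjective_comp_apply hψ ⟨ρ, hker⟩ p
    have hφsurj : Function.Surjective φ := fun q => by
      obtain ⟨p, hp⟩ := map_surjective (residue R) residue_surjective q
      exact ⟨ψ p, by rw [hφψ, hρ, coe_mapRingHom, hp]⟩
    have hkerφ : RingHom.ker φ ≤ Q := by
      intro a' ha'
      obtain ⟨p, rfl⟩ := hψ a'
      rw [RingHom.mem_ker, hφψ, hρker] at ha'
      have h1 : ψ p ∈ (maximalIdeal R).map (algebraMap R A) := aeval_mem_map_incl_of_coeff_mem ha'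
      rw [hmS] at h1
      exact (Ideal.span_singleton_le_iff_mem _).mpr hxQ h1
    -- the image prime `Q̄ = φ(Q)` of `κ[X]`, `φ t ∉ Q̄`, `φ(t) F̄ ∈ Q̄ᵉ⁺¹`
    haveI hQ' : (Q.map φ).IsPrime := Ideal.map_isPrime_of_surjective hφsurj hkerφ
    have htQ' : φ t ∉ Q.map φ := by
      intro hmem
      apply htQ
      have h1 : t ∈ (Q.map φ).comap φ := Ideal.mem_comap.mpr hmem
      rw [Ideal.comap_map_of_surjective φ hφsurj] at h1
      refine (sup_le le_rfl ?_ : Q ⊔ Ideal.comap φ ⊥ ≤ Q) h1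
      intro z hz
      exact hkerφ (by rwa [RingHom.mem_ker, ← Ideal.mem_bot, ← Ideal.mem_comap])
    have hmem' : φ t * φ s ∈ (Q.map φ) ^ (e + 1) := by
      rw [← map_mul, ← Ideal.map_pow]
      exact Ideal.mem_map_of_mem φ hts
    have hφs : φ s = ρ F := by rw [← hψF, hφψ]
    have hρF0 : ρ F ≠ 0 := fun h0 =>
      hge1 (mem_pow_succ_of_coeff_mem_strictTransform hm hx0K hFdeg ((hρker F).mp h0) hgF)
    have hdeg : (ρ F).natDegree ≤ e := by
      rw [hρ, coe_mapRingHom]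
      exact natDegree_map_le.trans hFdeg
    rw [hφs] at hmem'
    exact absurd (lt_natDegree_of_mul_mem_pow_strictTransform htQ' hmem' hρF0) (not_lt.mpr hdeg)

end Summit.ResolutionOfSingularities.ResolutionOfSingularities.Theorems.PfaffLine

end
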